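import Literature.Barriers.FinalStateConjecture.NonSmoothNullInfinityDecayZero
import Mathlib.Analysis.SpecialFunctions.Log.Deriv
import HarnessLib

/-!
# Barrier catalogue `FinalStateConjecture`: the linear scattering problem on Schwarzschild —
# the calculus of asymptotic expansions in `1/r` along outgoing null lines
(`Literature/Barriers/FinalStateConjecture/`, D-0021, D-0014; namespace
`Literature.Barriers.FinalStateConjecture`, sub-namespace `VExp`)

Kehrberger's expansion (6.18) of `∂ᵥ(rφ)` towards `𝓘⁺` (arXiv:2105.08079v3, Thms. 4.3 and 6.2),
`∂ᵥ(rφ)(u, v) = Σ_{i ≤ n} f_i(u)/r^{3+i} − (−1)ⁿ (3+n)! I⁽ⁿ⁾[G] M (log r − log|u|)/r^{4+n} + O(r^{−4−n})`,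
is an identity between functions of `v` at fixed retarded time `u`, asserted together with all its
`v`-derivatives. This file sets up the bookkeeping of such expansions along an outgoing null line
`u = const` of an Eddington–Finkelstein area radius `r` (`∂ᵥ r = 1 − 2M/r`), with `ρ = 1/r(u, v)`:

* `VExp.IsRem r u k E` — **the remainder class**: `E` is smooth and `∂ᵥ^m E = O(ρ^{k+m})` as
  `v → ∞` for every `m`; closed under sums, scalars, `∂ᵥ` (`k ↦ k + 1`), products
  (`IsRem.mul`, orders add), and decreasing the order;
* polynomial terms: `∂ᵥ P(ρ) = (δP)(ρ)` with `δP = −P'(X² − 2MX³)` (`ScatDecay.vDerivPoly`), so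
  `X^j ∣ P ⇒ P(ρ) ∈ IsRem j` (`VExp.isRem_eval_of_dvd`), and the normalisation of a polynomial
  expansion, `Q(ρ) = Σ_{i ≤ n} Q_{3+i} ρ^{3+i} + IsRem (4+n)` for `X³ ∣ Q` (`VExp.isRem_eval_sub_sum`);
* the logarithm `Λ = log r(u,v) − log|u|`: `∂ᵥ Λ = ρ − 2Mρ²`,
  `∂ᵥ^m (Λ P(ρ)) = Λ (δ^m P)(ρ) + (R_m P)(ρ)` with `X^{j+m} ∣ R_m P` (`VExp.logRemPoly`), whence
  `X^{k+1} ∣ P ⇒ Λ P(ρ) ∈ IsRem k` (`VExp.isRem_logRatio_mul_eval`);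
* tails towards `𝓘⁺`: `∫_v^∞ ρ^{k} dv' ≤ 2ρ^{k−1}/(k−1)` on `r ≥ 4M`, `E ∈ IsRem (k+2) ⇒
  ∫_v^∞ E ∈ IsRem (k+1)` (`VExp.IsRem.tail`), and the explicit tails of inverse powers,
  `∫_v^∞ ρ^j = −A_{j,P}(ρ) − γ ∫_v^∞ ρ^{j+P+1}` with `δ A_{j,P} = X^j + γ X^{j+P+1}`
  (`VExp.tailPoly`, `VExp.integral_Ioi_inv_pow_eq`) — the "`rφ^T(u,v) = rφ^T(u,∞) −
  ∫_v^∞ ∂ᵥ(rφ^T)`" step in the proof of Thm. 6.2.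

Everything is elementary one-variable calculus; [folklore] throughout.

## References

* L. M. A. Kehrberger, *The case against smooth null infinity I*, Ann. Henri Poincaré 23 (2022)
  829–921 = arXiv:2105.08079 (v3, 2023), proofs of Thm. 4.3 and Thm. 6.2. Key `Kehrberger2022AHP`.
-/

noncomputable section

open Set Filter Topology MeasureTheory intervalIntegral Function Asymptotics Polynomial
open Literature.Barriers.FinalStateConjecture.ScatDecay

namespace Literature.Barriers.FinalStateConjecture

namespace VExp

/-! ### The remainder class -/

/-- **The remainder class of order `k` along the outgoing null line `u = const`**: `E` is smooth
and `∂ᵥ^m E(v) = O(r(u,v)^{−k−m})` as `v → ∞`, for every `m`. [folklore] -/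
def IsRem (r : ℝ → ℝ → ℝ) (u : ℝ) (k : ℕ) (E : ℝ → ℝ) : Prop :=
  ContDiff ℝ ((⊤ : ℕ∞) : WithTop ℕ∞) E ∧ ∀ m : ℕ, iteratedDeriv m E =O[atTop] fun v ↦ (r u v ^ (k + m))⁻¹

section Basic

variable {M : ℝ} {r : ℝ → ℝ → ℝ} (hr : IsEFAreaRadius M r) (hM : 0 < M) {u : ℝ} {k j : ℕ} {E F : ℝ → ℝ}

omit hr hM in
/-- Smoothness of a remainder. [folklore] -/
lemma IsRem.contDiff (h : IsRem r u k E) : ContDiff ℝ ((⊤ : ℕ∞) : WithTop ℕ∞) E := h.1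

omit hr hM in
/-- The defining bound of a remainder. [folklore] -/
lemma IsRem.isBigO (h : IsRem r u k E) (m : ℕ) :
    iteratedDeriv m E =O[atTop] fun v ↦ (r u v ^ (k + m))⁻¹ := h.2 m

omit hr hM in
/-- The defining bound in the shape of the named fact (`1/r^{k+m}`). [folklore] -/
lemma IsRem.isBigO_one_div (h : IsRem r u k E) (m : ℕ) :
    iteratedDeriv m E =O[atTop] fun v ↦ 1 / r u v ^ (k + m) := by
  simpa only [one_div] using h.2 m

omit hr hM in
/-- `ContDiffAt` at a finite order, from smoothness. [folklore] -/
lemma contDiffAt_of_contDiff {E : ℝ → ℝ} (h : ContDiff ℝ ((⊤ : ℕ∞) : WithTop ℕ∞) E) (m : ℕ) (v : ℝ) :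
    ContDiffAt ℝ m E v :=
  (h.of_le (by exact_mod_cast le_top)).contDiffAt

omit hr hM in
/-- The zero function is a remainder of every order. [folklore] -/
lemma isRem_zero (r : ℝ → ℝ → ℝ) (u : ℝ) (k : ℕ) : IsRem r u k (fun _ ↦ 0) := by
  refine ⟨contDiff_const, fun m ↦ ?_⟩
  have : iteratedDeriv m (fun _ : ℝ ↦ (0 : ℝ)) = fun _ ↦ 0 := by
    funext v; rw [iteratedDeriv_const]; simp
  rw [this]
  exact isBigO_zero _ _

omit hr hM in
/-- Sums of remainders. [folklore] -/
theorem IsRem.add (hE : IsRem r u k E) (hF : IsRem r u k F) : IsRem r u k (fun v ↦ E v + F v) := by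
  refine ⟨hE.1.add hF.1, fun m ↦ ?_⟩
  have : iteratedDeriv m (fun v ↦ E v + F v) = fun v ↦ iteratedDeriv m E v + iteratedDeriv m F v :=
    funext fun v ↦ iteratedDeriv_fun_add (contDiffAt_of_contDiff hE.1 m v) (contDiffAt_of_contDiff hF.1 m v)
  rw [this]
  exact (hE.2 m).add (hF.2 m)

omit hr hM in
/-- Scalar multiples of remainders. [folklore] -/
theorem IsRem.const_mul (hE : IsRem r u k E) (c : ℝ) : IsRem r u k (fun v ↦ c * E v) := by
  refine ⟨contDiff_const.mul hE.1, fun m ↦ ?_⟩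
  have : iteratedDeriv m (fun v ↦ c * E v) = fun v ↦ c * iteratedDeriv m E v :=
    funext fun v ↦ iteratedDeriv_const_mul c (contDiffAt_of_contDiff hE.1 m v)
  rw [this]
  exact (hE.2 m).const_mul_left c

omit hr hM in
/-- Negatives of remainders. [folklore] -/
theorem IsRem.neg (hE : IsRem r u k E) : IsRem r u k (fun v ↦ -E v) := by
  have h := hE.const_mul (-1)
  simpa using h

omit hr hM in
/-- Differences of remainders. [folklore] -/
theorem IsRem.sub (hE : IsRem r u k E) (hF : IsRem r u k F) : IsRem r u k (fun v ↦ E v - F v) := by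
  have h := hE.add hF.neg
  simpa [sub_eq_add_neg] using h

omit hr hM in
/-- Finite sums of remainders. [folklore] -/
theorem IsRem.sum {ι : Type*} (s : Finset ι) {E : ι → ℝ → ℝ} (h : ∀ i ∈ s, IsRem r u k (E i)) :
    IsRem r u k (fun v ↦ ∑ i ∈ s, E i v) := by
  classical
  induction s using Finset.induction_on with
  | empty => simpa using isRem_zero r u k
  | @insert a s ha ih =>
    have h' := (h a (Finset.mem_insert_self a s)).add (ih fun i hi ↦ h i (Finset.mem_insert_of_mem hi))
    simpa [Finset.sum_insert ha] using h'

omit hr hM in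
/-- `∂ᵥ` raises the order of a remainder by one. [folklore] -/
theorem IsRem.deriv (hE : IsRem r u k E) : IsRem r u (k + 1) (deriv E) := by
  refine ⟨(contDiff_infty_iff_deriv.1 hE.1).2, fun m ↦ ?_⟩
  rw [← iteratedDeriv_succ', show k + 1 + m = k + (m + 1) by ring]
  exact hE.2 (m + 1)

include hr hM in
/-- `r(u, v) → ∞` along the outgoing null line, so `1/r^k = O(1/r^j)` for `j ≤ k`. [folklore] -/
lemma isBigO_inv_pow_of_le (u : ℝ) (hjk : j ≤ k) :
    (fun v ↦ (r u v ^ k)⁻¹) =O[atTop] fun v ↦ (r u v ^ j)⁻¹ := by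
  refine IsBigO.of_bound 1 ?_
  filter_upwards [(hr.tendsto_atTop hM.le u).eventually (eventually_ge_atTop 1)] with v hv
  have h0 : 0 < r u v := hr.pos hM.le u v
  rw [Real.norm_eq_abs, Real.norm_eq_abs, abs_of_pos (by positivity), abs_of_pos (by positivity), one_mul]
  exact inv_anti₀ (by positivity) (pow_le_pow_right₀ hv hjk)

include hr hM in
/-- Decreasing the order of a remainder. [folklore] -/
theorem IsRem.mono (hE : IsRem r u k E) (hjk : j ≤ k) : IsRem r u j E :=
  ⟨hE.1, fun m ↦ (hE.2 m).trans (isBigO_inv_pow_of_le hr hM u (by omega))⟩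

omit hr hM in
/-- **Products of remainders: the orders add** (Leibniz rule). [folklore] -/
theorem IsRem.mul (hE : IsRem r u j E) (hF : IsRem r u k F) : IsRem r u (j + k) (fun v ↦ E v * F v) := by
  refine ⟨hE.1.mul hF.1, fun m ↦ ?_⟩
  have hfun : iteratedDeriv m (fun v ↦ E v * F v) = fun v ↦ ∑ i ∈ Finset.range (m + 1),
      (m.choose i : ℝ) * iteratedDeriv i E v * iteratedDeriv (m - i) F v :=
    funext fun v ↦ iteratedDeriv_fun_mul (contDiffAt_of_contDiff hE.1 m v) (contDiffAt_of_contDiff hF.1 m v)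
  rw [hfun]
  refine IsBigO.sum fun i hi ↦ ?_
  have him : i ≤ m := Nat.lt_succ_iff.mp (Finset.mem_range.mp hi)
  have h1 := ((hE.2 i).const_mul_left (m.choose i : ℝ)).mul (hF.2 (m - i))
  refine h1.congr_right fun v ↦ ?_
  rw [← mul_inv, ← pow_add]
  congr 2
  omega

end Basic

/-! ### Polynomial terms -/

section Poly

variable {M : ℝ} {r : ℝ → ℝ → ℝ} (hr : IsEFAreaRadius M r) (hM : 0 < M)

/-- `X^j ∣ P ⇒ X^{j+1} ∣ δP`. [folklore] -/
lemma X_pow_dvd_vDerivPoly {j : ℕ} {P : ℝ[X]} (h : X ^ j ∣ P) : X ^ (j + 1) ∣ vDerivPoly M P := by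
  obtain ⟨S, rfl⟩ := h
  rcases Nat.eq_zero_or_pos j with rfl | hj
  · refine ⟨-(derivative S * (1 - C (2 * M) * X)) * X, ?_⟩
    simp only [vDerivPoly, invRadiusDerivPoly, pow_zero, one_mul]
    ring
  · exact ⟨_, vDerivPoly_X_pow_mul hj S⟩

/-- `X^j ∣ P ⇒ X^{j+m} ∣ δ^m P`. [folklore] -/
lemma X_pow_dvd_iterate_vDerivPoly {j : ℕ} {P : ℝ[X]} (h : X ^ j ∣ P) (m : ℕ) :
    X ^ (j + m) ∣ (vDerivPoly M)^[m] P := by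
  induction m with
  | zero => simpa using h
  | succ m ih =>
    rw [Function.iterate_succ_apply', ← add_assoc]
    exact X_pow_dvd_vDerivPoly ih

include hr hM in
/-- `X^j ∣ Q ⇒ |Q(ρ)| ≤ K ρ^j`. [folklore] -/
lemma exists_abs_eval_le_of_dvd {j : ℕ} {Q : ℝ[X]} (h : X ^ j ∣ Q) :
    ∃ K : ℝ, 0 ≤ K ∧ ∀ u v, |Q.eval (r u v)⁻¹| ≤ K * (r u v ^ j)⁻¹ := by
  obtain ⟨S, rfl⟩ := h
  obtain ⟨K, hK⟩ := exists_bound_eval_invRadius hr hM S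
  refine ⟨K, (abs_nonneg _).trans (hK 0 0), fun u v ↦ ?_⟩
  have h0 : 0 < r u v := hr.pos hM.le u v
  rw [eval_mul, eval_pow, eval_X, abs_mul, ← inv_pow, abs_of_pos (by positivity), mul_comm]
  exact mul_le_mul_of_nonneg_right (hK u v) (by positivity)

include hr hM in
/-- **`X^j ∣ P ⇒ P(1/r(u, ·)) ∈ IsRem j`.** [folklore] -/
theorem isRem_eval_of_dvd (u : ℝ) {j : ℕ} {P : ℝ[X]} (h : X ^ j ∣ P) :
    IsRem r u j (fun v ↦ P.eval (r u v)⁻¹) := by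
  refine ⟨contDiff_eval_invRadius_right hr hM P u, fun m ↦ ?_⟩
  obtain ⟨K, -, hK⟩ := exists_abs_eval_le_of_dvd hr hM (X_pow_dvd_iterate_vDerivPoly (M := M) h m)
  have hfun : iteratedDeriv m (fun v ↦ P.eval (r u v)⁻¹) = fun v ↦ ((vDerivPoly M)^[m] P).eval (r u v)⁻¹ :=
    funext fun v ↦ iteratedDeriv_eval_invRadius hr hM P m u v
  rw [hfun]
  refine IsBigO.of_bound K (Eventually.of_forall fun v ↦ ?_)
  rw [Real.norm_eq_abs, Real.norm_eq_abs, abs_of_pos (inv_pos.2 (pow_pos (hr.pos hM.le u v) _))]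
  exact hK u v

include hr hM in
/-- `1/r(u, ·)^j ∈ IsRem j`. [folklore] -/
theorem isRem_inv_pow (u : ℝ) (j : ℕ) : IsRem r u j (fun v ↦ (r u v ^ j)⁻¹) := by
  have h := isRem_eval_of_dvd hr hM u (dvd_refl ((X : ℝ[X]) ^ j))
  refine (show (fun v ↦ (r u v ^ j)⁻¹) = fun v ↦ ((X : ℝ[X]) ^ j).eval (r u v)⁻¹ from ?_) ▸ h
  funext v; simp [inv_pow]

include hr hM in
/-- `X^j ∣ P`, `E ∈ IsRem k ⇒ P(ρ) E ∈ IsRem (j + k)`. [folklore] -/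
theorem IsRem.eval_mul (u : ℝ) {j k : ℕ} {P : ℝ[X]} (h : X ^ j ∣ P) {E : ℝ → ℝ} (hE : IsRem r u k E) :
    IsRem r u (j + k) (fun v ↦ P.eval (r u v)⁻¹ * E v) :=
  (isRem_eval_of_dvd hr hM u h).mul hE

/-- `δ(X^q) = −q X^{q+1} + 2Mq X^{q+2}`. [folklore] -/
lemma vDerivPoly_X_pow (M : ℝ) (q : ℕ) :
    vDerivPoly M (X ^ q) = -C (q : ℝ) * X ^ (q + 1) + C (2 * M * q) * X ^ (q + 2) := by
  rcases Nat.eq_zero_or_pos q with rfl | hq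
  · simp [vDerivPoly]
  · have h := vDerivPoly_X_pow_mul (M := M) hq 1
    rw [mul_one] at h
    rw [h]
    simp only [derivative_one, mul_zero, add_zero, map_mul]
    ring

/-- **Normalisation of a polynomial expansion**: if `X³ ∣ Q` then
`Q(ρ) − Σ_{i ≤ n} Q_{3+i} ρ^{3+i} ∈ IsRem (4 + n)`. [folklore] -/
theorem isRem_eval_sub_sum (hr : IsEFAreaRadius M r) (hM : 0 < M) (u : ℝ) {Q : ℝ[X]} (h3 : X ^ 3 ∣ Q) (n : ℕ) :
    IsRem r u (4 + n) (fun v ↦ Q.eval (r u v)⁻¹ -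
      ∑ i ∈ Finset.range (n + 1), Q.coeff (3 + i) * (r u v ^ (3 + i))⁻¹) := by
  set R : ℝ[X] := Q - ∑ i ∈ Finset.range (n + 1), C (Q.coeff (3 + i)) * X ^ (3 + i) with hR
  have hdvd : X ^ (4 + n) ∣ R := by
    rw [X_pow_dvd_iff]
    intro d hd
    simp only [hR, coeff_sub, finsetSum_coeff, coeff_C_mul, coeff_X_pow]
    rcases lt_or_ge d 3 with hd3 | hd3
    · have h0 : Q.coeff d = 0 := (X_pow_dvd_iff.1 h3) d hd3
      rw [h0, Finset.sum_eq_zero fun i _ ↦ by rw [if_neg (by omega), mul_zero], sub_zero]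
    · obtain ⟨i, rfl⟩ : ∃ i, d = 3 + i := ⟨d - 3, by omega⟩
      rw [Finset.sum_eq_single i (fun b _ hb ↦ by rw [if_neg (by omega), mul_zero])
        (fun hi ↦ absurd (Finset.mem_range.2 (by omega)) hi), if_pos rfl, mul_one, sub_self]
  have h := isRem_eval_of_dvd hr hM u hdvd
  refine (show (fun v ↦ Q.eval (r u v)⁻¹ - ∑ i ∈ Finset.range (n + 1), Q.coeff (3 + i) * (r u v ^ (3 + i))⁻¹) =
    fun v ↦ R.eval (r u v)⁻¹ from funext fun v ↦ ?_) ▸ h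
  simp only [hR, eval_sub, eval_finsetSum, eval_mul, eval_C, eval_pow, eval_X, inv_pow]

end Poly

/-! ### The logarithm -/

section Log

variable {M : ℝ} {r : ℝ → ℝ → ℝ} (hr : IsEFAreaRadius M r) (hM : 0 < M)

/-- `Λ(u, v) := log r(u, v) − log|u|`, the logarithm of the expansion (6.18). [folklore] -/
def logRatio (r : ℝ → ℝ → ℝ) (u v : ℝ) : ℝ := Real.log (r u v) - Real.log |u|

/-- `∂ᵥ log r = ρ − 2Mρ²` as a polynomial in `ρ`. [folklore] -/
def logDerivPoly (M : ℝ) : ℝ[X] := X - C (2 * M) * X ^ 2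

/-- `X ∣ logDerivPoly`. [folklore] -/
lemma X_dvd_logDerivPoly (M : ℝ) : X ∣ logDerivPoly M := ⟨1 - C (2 * M) * X, by simp only [logDerivPoly]; ring⟩

include hr hM in
/-- `∂ᵥ Λ = (ρ − 2Mρ²)`. [folklore] -/
lemma hasDerivAt_logRatio (u v : ℝ) :
    HasDerivAt (fun v' ↦ logRatio r u v') ((logDerivPoly M).eval (r u v)⁻¹) v := by
  have h0 : 0 < r u v := hr.pos hM.le u v
  have h := ((hr.2.1 u v).log h0.ne').sub_const (Real.log |u|)
  refine h.congr_deriv ?_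
  simp only [logDerivPoly, eval_sub, eval_mul, eval_C, eval_pow, eval_X]
  field_simp

include hr hM in
/-- `v ↦ Λ(u, v)` is smooth. [folklore] -/
lemma contDiff_logRatio (u : ℝ) : ContDiff ℝ ((⊤ : ℕ∞) : WithTop ℕ∞) (fun v ↦ logRatio r u v) :=
  (((hr.contDiff_uncurry hM).comp (contDiff_prodMk_right u)).log fun v ↦ (hr.pos hM.le u v).ne').sub
    contDiff_const

/-- The polynomial part of `∂ᵥ^m (Λ P(ρ))`: `R_0 = 0`, `R_{m+1} = δ R_m + (X − 2MX²) δ^m P`. [folklore] -/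
def logRemPoly (M : ℝ) (P : ℝ[X]) : ℕ → ℝ[X]
  | 0 => 0
  | m + 1 => vDerivPoly M (logRemPoly M P m) + logDerivPoly M * (vDerivPoly M)^[m] P

include hr hM in
/-- **`∂ᵥ^m (Λ P(ρ)) = Λ (δ^m P)(ρ) + (R_m P)(ρ)`.** [folklore] -/
theorem iteratedDeriv_logRatio_mul_eval (P : ℝ[X]) (m : ℕ) (u v : ℝ) :
    iteratedDeriv m (fun v' ↦ logRatio r u v' * P.eval (r u v')⁻¹) v =
      logRatio r u v * ((vDerivPoly M)^[m] P).eval (r u v)⁻¹ + (logRemPoly M P m).eval (r u v)⁻¹ := by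
  induction m generalizing v with
  | zero => simp [logRemPoly]
  | succ m ih =>
    rw [iteratedDeriv_succ]
    have hfun : iteratedDeriv m (fun v' ↦ logRatio r u v' * P.eval (r u v')⁻¹) = fun v' ↦
        logRatio r u v' * ((vDerivPoly M)^[m] P).eval (r u v')⁻¹ + (logRemPoly M P m).eval (r u v')⁻¹ :=
      funext ih
    rw [hfun]
    have hd : HasDerivAt (fun v' ↦ logRatio r u v' * ((vDerivPoly M)^[m] P).eval (r u v')⁻¹ +
        (logRemPoly M P m).eval (r u v')⁻¹)
        ((logDerivPoly M).eval (r u v)⁻¹ * ((vDerivPoly M)^[m] P).eval (r u v)⁻¹ +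
          logRatio r u v * (vDerivPoly M ((vDerivPoly M)^[m] P)).eval (r u v)⁻¹ +
          (vDerivPoly M (logRemPoly M P m)).eval (r u v)⁻¹) v :=
      ((hasDerivAt_logRatio hr hM u v).mul (hasDerivAt_eval_invRadius_vDerivPoly hr hM _ u v)).add
        (hasDerivAt_eval_invRadius_vDerivPoly hr hM _ u v)
    rw [hd.deriv, Function.iterate_succ_apply']
    simp only [logRemPoly, eval_add, eval_mul]
    ring

/-- `X^j ∣ P ⇒ X^{j+m} ∣ R_m P`. [folklore] -/
lemma X_pow_dvd_logRemPoly {j : ℕ} {P : ℝ[X]} (h : X ^ j ∣ P) (m : ℕ) :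
    X ^ (j + m) ∣ logRemPoly M P m := by
  induction m with
  | zero => exact dvd_zero _
  | succ m ih =>
    simp only [logRemPoly]
    refine dvd_add ?_ ?_
    · rw [← add_assoc]; exact X_pow_dvd_vDerivPoly ih
    · rw [show j + (m + 1) = 1 + (j + m) by ring, pow_add, pow_one]
      exact mul_dvd_mul (X_dvd_logDerivPoly M) (X_pow_dvd_iterate_vDerivPoly h m)

include hr hM in
/-- `|Λ(u, v)|/r(u, v)` is bounded along the outgoing null line. [folklore] -/
lemma exists_abs_logRatio_mul_inv_le (u : ℝ) : ∃ L : ℝ, 0 ≤ L ∧ ∀ v, |logRatio r u v| * (r u v)⁻¹ ≤ L := by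
  refine ⟨1 + |Real.log (2 * M)| * (2 * M)⁻¹ + |Real.log (|u|)| * (2 * M)⁻¹, by positivity, fun v ↦ ?_⟩
  have h0 : 0 < r u v := hr.pos hM.le u v
  have h2 : 2 * M < r u v := hr.1 u v
  have hρ : (r u v)⁻¹ ≤ (2 * M)⁻¹ := (inv_le_inv₀ h0 (by positivity)).2 h2.le
  have hlog : |Real.log (r u v)| * (r u v)⁻¹ ≤ 1 + |Real.log (2 * M)| * (2 * M)⁻¹ := by
    rcases le_or_gt 1 (r u v) with h1 | h1
    · have hl : 0 ≤ Real.log (r u v) := Real.log_nonneg h1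
      have hle : Real.log (r u v) ≤ r u v := (Real.log_le_sub_one_of_pos h0).trans (by linarith)
      rw [abs_of_nonneg hl]
      calc Real.log (r u v) * (r u v)⁻¹ ≤ r u v * (r u v)⁻¹ := mul_le_mul_of_nonneg_right hle (by positivity)
        _ = 1 := mul_inv_cancel₀ h0.ne'
        _ ≤ 1 + |Real.log (2 * M)| * (2 * M)⁻¹ := by
            have : 0 ≤ |Real.log (2 * M)| * (2 * M)⁻¹ := by positivity
            linarith
    · have hl : Real.log (r u v) < 0 := Real.log_neg h0 h1
      have hl2 : Real.log (2 * M) < Real.log (r u v) := Real.log_lt_log (by positivity) h2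
      have habs : |Real.log (r u v)| ≤ |Real.log (2 * M)| := by
        rw [abs_of_neg hl, abs_of_neg (hl2.trans hl)]; linarith
      calc |Real.log (r u v)| * (r u v)⁻¹ ≤ |Real.log (2 * M)| * (2 * M)⁻¹ :=
            mul_le_mul habs hρ (by positivity) (abs_nonneg _)
        _ ≤ 1 + |Real.log (2 * M)| * (2 * M)⁻¹ := by linarith
  calc |logRatio r u v| * (r u v)⁻¹ ≤ (|Real.log (r u v)| + |Real.log (|u|)|) * (r u v)⁻¹ :=
        mul_le_mul_of_nonneg_right (abs_sub _ _) (by positivity)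
    _ = |Real.log (r u v)| * (r u v)⁻¹ + |Real.log (|u|)| * (r u v)⁻¹ := by ring
    _ ≤ (1 + |Real.log (2 * M)| * (2 * M)⁻¹) + |Real.log (|u|)| * (2 * M)⁻¹ :=
        add_le_add hlog (mul_le_mul_of_nonneg_left hρ (abs_nonneg _))

include hr hM in
/-- **`X^{k+1} ∣ P ⇒ Λ P(ρ) ∈ IsRem k`** (one order is lost to the logarithm). [folklore] -/
theorem isRem_logRatio_mul_eval (u : ℝ) {k : ℕ} {P : ℝ[X]} (h : X ^ (k + 1) ∣ P) :
    IsRem r u k (fun v ↦ logRatio r u v * P.eval (r u v)⁻¹) := by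
  refine ⟨(contDiff_logRatio hr hM u).mul (contDiff_eval_invRadius_right hr hM P u), fun m ↦ ?_⟩
  obtain ⟨L, hL0, hL⟩ := exists_abs_logRatio_mul_inv_le hr hM u
  obtain ⟨K, hK0, hK⟩ := exists_abs_eval_le_of_dvd hr hM (X_pow_dvd_iterate_vDerivPoly (M := M) h m)
  obtain ⟨K', -, hK'⟩ := exists_abs_eval_le_of_dvd hr hM (X_pow_dvd_logRemPoly (M := M) h m)
  have hfun : iteratedDeriv m (fun v' ↦ logRatio r u v' * P.eval (r u v')⁻¹) = fun v ↦
      logRatio r u v * ((vDerivPoly M)^[m] P).eval (r u v)⁻¹ + (logRemPoly M P m).eval (r u v)⁻¹ :=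
    funext fun v ↦ iteratedDeriv_logRatio_mul_eval hr hM P m u v
  rw [hfun]
  refine IsBigO.add ?_ ?_
  · refine IsBigO.of_bound (L * K) (Eventually.of_forall fun v ↦ ?_)
    have h0 : 0 < r u v := hr.pos hM.le u v
    rw [Real.norm_eq_abs, Real.norm_eq_abs, abs_of_pos (inv_pos.2 (pow_pos h0 _)), abs_mul]
    have hexp : (r u v ^ (k + 1 + m))⁻¹ = (r u v)⁻¹ * (r u v ^ (k + m))⁻¹ := by
      rw [← mul_inv, ← pow_succ']; congr 1; ring
    calc |logRatio r u v| * |((vDerivPoly M)^[m] P).eval (r u v)⁻¹|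
        ≤ |logRatio r u v| * (K * (r u v ^ (k + 1 + m))⁻¹) := mul_le_mul_of_nonneg_left (hK u v) (abs_nonneg _)
      _ = (|logRatio r u v| * (r u v)⁻¹) * (K * (r u v ^ (k + m))⁻¹) := by rw [hexp]; ring
      _ ≤ L * (K * (r u v ^ (k + m))⁻¹) := mul_le_mul_of_nonneg_right (hL v) (by positivity)
      _ = L * K * (r u v ^ (k + m))⁻¹ := by ring
  · refine (IsBigO.of_bound K' (Eventually.of_forall fun v ↦ ?_)).trans
      (isBigO_inv_pow_of_le hr hM u (show k + m ≤ k + 1 + m by omega))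
    rw [Real.norm_eq_abs, Real.norm_eq_abs, abs_of_pos (inv_pos.2 (pow_pos (hr.pos hM.le u v) _))]
    exact hK' u v

include hr hM in
/-- `Λ/r^{k+1} ∈ IsRem k`. [folklore] -/
theorem isRem_logRatio_mul_inv_pow (u : ℝ) (k : ℕ) :
    IsRem r u k (fun v ↦ logRatio r u v * (r u v ^ (k + 1))⁻¹) := by
  have h := isRem_logRatio_mul_eval hr hM u (dvd_refl ((X : ℝ[X]) ^ (k + 1)))
  refine (show (fun v ↦ logRatio r u v * (r u v ^ (k + 1))⁻¹) =
    fun v ↦ logRatio r u v * ((X : ℝ[X]) ^ (k + 1)).eval (r u v)⁻¹ from ?_) ▸ h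
  funext v; simp [inv_pow]

include hr hM in
/-- **The derivative of the logarithmic term**:
`∂ᵥ (Λ ρ^q) = (ρ − 2Mρ²) ρ^q − q Λ ρ^{q+1} + 2Mq Λ ρ^{q+2}`. [folklore] -/
theorem hasDerivAt_logRatio_mul_inv_pow (u v : ℝ) (q : ℕ) :
    HasDerivAt (fun v' ↦ logRatio r u v' * (r u v' ^ q)⁻¹)
      ((logDerivPoly M).eval (r u v)⁻¹ * (r u v ^ q)⁻¹ +
        logRatio r u v * (-(q : ℝ) * (r u v ^ (q + 1))⁻¹ + 2 * M * q * (r u v ^ (q + 2))⁻¹)) v := by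
  have h := (hasDerivAt_logRatio hr hM u v).mul (hasDerivAt_eval_invRadius_vDerivPoly hr hM (X ^ q) u v)
  have hfun : (fun v' ↦ logRatio r u v' * (r u v' ^ q)⁻¹) = fun v' ↦ logRatio r u v' * ((X : ℝ[X]) ^ q).eval (r u v')⁻¹ := by
    funext v'; simp [inv_pow]
  rw [hfun]
  refine h.congr_deriv ?_
  rw [vDerivPoly_X_pow]
  simp only [eval_pow, eval_X, eval_add, eval_mul, eval_neg, eval_C, inv_pow]

end Log

/-! ### Tails towards `𝓘⁺` -/

section Tail

variable {M : ℝ} {r : ℝ → ℝ → ℝ} (hr : IsEFAreaRadius M r) (hM : 0 < M)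
include hr hM

/-- **`∫_a^∞ r(u,v)^{−(n+2)} dv ≤ 2 r(u,a)^{−(n+1)}/(n+1)` once `r(u, a) ≥ 4M`** (compare with
`∂ᵥ [−((n+1) r^{n+1})⁻¹] = (1 − 2M/r)/r^{n+2} ≥ r^{−(n+2)}/2`), with integrability. [folklore] -/
theorem integral_Ioi_inv_pow_le (u : ℝ) (n : ℕ) {a : ℝ} (h4 : 4 * M ≤ r u a) :
    IntegrableOn (fun v ↦ (r u v ^ (n + 2))⁻¹) (Ioi a) ∧
      ∫ v in Ioi a, (r u v ^ (n + 2))⁻¹ ≤ 2 * (((n : ℝ) + 1) * r u a ^ (n + 1))⁻¹ := by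
  set g : ℝ → ℝ := fun v' ↦ -(((n : ℝ) + 1) * r u v' ^ (n + 1))⁻¹ with hg
  set g' : ℝ → ℝ := fun v' ↦ (1 - 2 * M / r u v') / r u v' ^ (n + 2) with hg'
  have hderiv : ∀ x : ℝ, HasDerivAt g (g' x) x := by
    intro x
    have h0 : r u x ≠ 0 := (hr.pos hM.le u x).ne'
    have hc : HasDerivAt (fun v' : ℝ ↦ ((n : ℝ) + 1) * r u v' ^ (n + 1))
        (((n : ℝ) + 1) * (((n + 1 : ℕ) : ℝ) * r u x ^ (n + 1 - 1) * (1 - 2 * M / r u x))) x :=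
      ((hr.2.1 u x).pow (n + 1)).const_mul _
    have hne : ((n : ℝ) + 1) * r u x ^ (n + 1) ≠ 0 := by
      have := hr.pos hM.le u x; positivity
    refine ((hc.inv hne).neg).congr_deriv ?_
    rw [Nat.add_sub_cancel]
    simp only [hg']
    push_cast
    field_simp
    ring
  have hpos : ∀ x ∈ Ioi a, 0 ≤ g' x := fun x _ ↦ by
    simp only [hg']
    exact div_nonneg (hr.factor_pos hM.le u x).le (pow_nonneg (hr.pos hM.le u x).le _)
  have hlim : Tendsto g atTop (𝓝 0) := by
    have h1 : Tendsto (fun v' : ℝ ↦ ((n : ℝ) + 1) * r u v' ^ (n + 1)) atTop atTop :=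
      Tendsto.const_mul_atTop (by positivity)
        ((tendsto_pow_atTop (by omega)).comp (hr.tendsto_atTop hM.le u))
    simpa [hg] using h1.inv_tendsto_atTop.neg
  have hint : IntegrableOn g' (Ioi a) :=
    integrableOn_Ioi_deriv_of_nonneg' (fun x _ ↦ hderiv x) hpos hlim
  have hval : ∫ x in Ioi a, g' x = 0 - g a :=
    integral_Ioi_of_hasDerivAt_of_tendsto' (fun x _ ↦ hderiv x) hint hlim
  have hcmp : ∀ x ∈ Ioi a, (r u x ^ (n + 2))⁻¹ ≤ 2 * g' x := by
    intro x hx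
    have h4x : 4 * M ≤ r u x := h4.trans ((hr.strictMono_right hM u).monotone (le_of_lt hx))
    have hD := factor_ge_half hM h4x
    have hp : 0 < r u x ^ (n + 2) := pow_pos (hr.pos hM.le u x) _
    simp only [hg']
    rw [inv_eq_one_div, mul_div_assoc', div_le_div_iff_of_pos_right hp]
    linarith
  have hc : Continuous fun v' ↦ (r u v' ^ (n + 2))⁻¹ :=
    ((hr.continuous_snd u).pow _).inv₀ fun v' ↦ pow_ne_zero _ (hr.pos hM.le u v').ne'
  have hint2 : IntegrableOn (fun v' ↦ (r u v' ^ (n + 2))⁻¹) (Ioi a) := by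
    refine Integrable.mono' (hint.const_mul 2) hc.aestronglyMeasurable ?_
    refine (ae_restrict_iff' measurableSet_Ioi).2 (Eventually.of_forall fun x hx ↦ ?_)
    rw [Real.norm_eq_abs, abs_of_pos (by have := hr.pos hM.le u x; positivity)]
    exact hcmp x hx
  refine ⟨hint2, ?_⟩
  calc ∫ v' in Ioi a, (r u v' ^ (n + 2))⁻¹ ≤ ∫ v' in Ioi a, 2 * g' v' :=
        setIntegral_mono_on hint2 (hint.const_mul 2) measurableSet_Ioi hcmp
    _ = 2 * (0 - g a) := by rw [MeasureTheory.integral_const_mul, hval]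
    _ = 2 * (((n : ℝ) + 1) * r u a ^ (n + 1))⁻¹ := by simp [hg]

/-- Eventually (in `v`) the defining bound of a remainder holds pointwise with a constant, and
`r ≥ 4M`. [folklore] -/
lemma IsRem.exists_bound {u : ℝ} {k : ℕ} {E : ℝ → ℝ} (hE : IsRem r u k E) (m : ℕ) :
    ∃ C v₀ : ℝ, 0 ≤ C ∧ 4 * M ≤ r u v₀ ∧ ∀ v, v₀ ≤ v → |iteratedDeriv m E v| ≤ C * (r u v ^ (k + m))⁻¹ := by
  obtain ⟨C, hC0, hC⟩ := (hE.2 m).exists_nonneg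
  rw [IsBigOWith, eventually_atTop] at hC
  obtain ⟨v₁, hv₁⟩ := hC
  obtain ⟨v₂, hv₂⟩ := eventually_atTop.1 ((hr.tendsto_atTop hM.le u).eventually (eventually_ge_atTop (4 * M)))
  refine ⟨C, max v₁ v₂, hC0, hv₂ _ (le_max_right _ _), fun v hv ↦ ?_⟩
  have h := hv₁ v ((le_max_left _ _).trans hv)
  rwa [Real.norm_eq_abs, Real.norm_eq_abs, abs_of_pos (inv_pos.2 (pow_pos (hr.pos hM.le u v) _))] at h

/-- A remainder of order `≥ 2` is integrable towards `𝓘⁺` (from any `a`). [folklore] -/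
theorem IsRem.integrableOn_Ioi {u : ℝ} {k : ℕ} {E : ℝ → ℝ} (hE : IsRem r u (k + 2) E) (a : ℝ) :
    IntegrableOn E (Ioi a) := by
  obtain ⟨C, v₀, hC0, h4, hb⟩ := hE.exists_bound hr hM 0
  simp only [iteratedDeriv_zero, add_zero] at hb
  have hc : Continuous E := hE.1.continuous
  -- on `(a, v₀]` by continuity, on `(v₀, ∞)` by domination
  have h1 : IntegrableOn E (Ioc a v₀) :=
    (hc.continuousOn.integrableOn_Icc (a := a) (b := v₀)).mono_set Ioc_subset_Icc_self
  have h2 : IntegrableOn E (Ioi v₀) := by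
    obtain ⟨hint, -⟩ := integral_Ioi_inv_pow_le hr hM u k h4
    refine Integrable.mono' (hint.const_mul C) hc.aestronglyMeasurable ?_
    refine (ae_restrict_iff' measurableSet_Ioi).2 (Eventually.of_forall fun x hx ↦ ?_)
    rw [Real.norm_eq_abs]
    exact hb x (le_of_lt hx)
  have h12 : IntegrableOn E (Ioc a v₀ ∪ Ioi v₀) := h1.union h2
  exact h12.mono_set fun x hx ↦ by
    rcases le_or_gt x v₀ with hx' | hx'
    · exact Or.inl ⟨hx, hx'⟩
    · exact Or.inr hx'

omit hr hM in
/-- The tail `v ↦ ∫_v^∞ E` has derivative `−E`. [folklore] -/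
theorem hasDerivAt_tail {E : ℝ → ℝ} (hc : Continuous E) (hint : ∀ a, IntegrableOn E (Ioi a)) (v : ℝ) :
    HasDerivAt (fun v' ↦ ∫ w in Ioi v', E w) (-E v) v := by
  have heq : (fun v' ↦ ∫ w in Ioi v', E w) = fun v' ↦ (∫ w in Ioi (v - 1), E w) - ∫ w in (v - 1)..v', E w := by
    funext v'
    rw [← intervalIntegral.integral_interval_add_Ioi (hint (v - 1)) (hint v')]
    ring
  rw [heq]
  have h : HasDerivAt (fun v' ↦ ∫ w in (v - 1)..v', E w) (E v) v :=
    intervalIntegral.integral_hasDerivAt_right (hc.intervalIntegrable _ _)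
      (hc.stronglyMeasurableAtFilter _ _) hc.continuousAt
  simpa using h.const_sub (∫ w in Ioi (v - 1), E w)

/-- **Tails of remainders: `E ∈ IsRem (k+2) ⇒ ∫_v^∞ E ∈ IsRem (k+1)`.** [folklore] -/
theorem IsRem.tail {u : ℝ} {k : ℕ} {E : ℝ → ℝ} (hE : IsRem r u (k + 2) E) :
    IsRem r u (k + 1) (fun v ↦ ∫ w in Ioi v, E w) := by
  have hc : Continuous E := hE.1.continuous
  have hint := hE.integrableOn_Ioi hr hM
  have hd : ∀ v, HasDerivAt (fun v' ↦ ∫ w in Ioi v', E w) (-E v) v := hasDerivAt_tail hc hint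
  have hderiv : _root_.deriv (fun v' ↦ ∫ w in Ioi v', E w) = fun v ↦ -E v := funext fun v ↦ (hd v).deriv
  have hsmooth : ContDiff ℝ ((⊤ : ℕ∞) : WithTop ℕ∞) (fun v' ↦ ∫ w in Ioi v', E w) := by
    refine contDiff_infty_iff_deriv.2 ⟨fun v ↦ (hd v).differentiableAt, ?_⟩
    rw [hderiv]; exact hE.1.neg
  refine ⟨hsmooth, fun m ↦ ?_⟩
  cases m with
  | zero =>
    -- `|∫_v^∞ E| ≤ C ∫_v^∞ r^{-(k+2)} ≤ 2C/((k+1) r^{k+1})`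
    obtain ⟨C, v₀, hC0, h4, hb⟩ := hE.exists_bound hr hM 0
    simp only [iteratedDeriv_zero, add_zero] at hb ⊢
    refine IsBigO.of_bound (2 * C * (((k : ℝ) + 1))⁻¹) ?_
    filter_upwards [eventually_ge_atTop v₀] with v hv
    have h4v : 4 * M ≤ r u v := h4.trans ((hr.strictMono_right hM u).monotone hv)
    obtain ⟨hintv, hle⟩ := integral_Ioi_inv_pow_le hr hM u k h4v
    have h0 : 0 < r u v := hr.pos hM.le u v
    rw [Real.norm_eq_abs, Real.norm_eq_abs, abs_of_pos (inv_pos.2 (pow_pos h0 _)), ← Real.norm_eq_abs]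
    calc ‖∫ w in Ioi v, E w‖ ≤ ∫ w in Ioi v, C * (r u w ^ (k + 2))⁻¹ := by
          refine norm_integral_le_of_norm_le (hintv.const_mul C) ?_
          refine (ae_restrict_iff' measurableSet_Ioi).2 (Eventually.of_forall fun w hw ↦ ?_)
          rw [Real.norm_eq_abs]
          exact hb w (hv.trans (le_of_lt hw))
      _ = C * ∫ w in Ioi v, (r u w ^ (k + 2))⁻¹ := MeasureTheory.integral_const_mul _ _
      _ ≤ C * (2 * (((k : ℝ) + 1) * r u v ^ (k + 1))⁻¹) := mul_le_mul_of_nonneg_left hle hC0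
      _ = 2 * C * ((k : ℝ) + 1)⁻¹ * (r u v ^ (k + 1))⁻¹ := by rw [mul_inv]; ring
  | succ m =>
    rw [iteratedDeriv_succ', hderiv, show k + 1 + (m + 1) = k + 2 + m by ring]
    have h := (hE.neg).2 m
    exact h

/-! ### Explicit tails of inverse powers -/

/-- The coefficients `α_p` of the tail polynomial: `α_0 = −1/(j−1)`, `α_{p+1} = 2M (j−1+p) α_p/(j+p)`.
[folklore] -/
def tailCoeff (M : ℝ) (j : ℕ) : ℕ → ℝ
  | 0 => -((j : ℝ) - 1)⁻¹
  | p + 1 => 2 * M * ((j : ℝ) - 1 + p) * tailCoeff M j p / ((j : ℝ) + p)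

/-- **The tail polynomial `A_{j,P} = Σ_{p ≤ P} α_p X^{j−1+p}`**, an approximate antiderivative of
`ρ^j`: `δ A_{j,P} = X^j + γ X^{j+P+1}`. [folklore] -/
def tailPoly (M : ℝ) (j P : ℕ) : ℝ[X] := ∑ p ∈ Finset.range (P + 1), C (tailCoeff M j p) * X ^ (j - 1 + p)

/-- The residual coefficient `γ_{j,P} = 2M (j − 1 + P) α_P`. [folklore] -/
def tailResidue (M : ℝ) (j P : ℕ) : ℝ := 2 * M * ((j : ℝ) - 1 + P) * tailCoeff M j P

omit hr hM in
/-- **`δ A_{j,P} = X^j + γ_{j,P} X^{j+P+1}`** for `j ≥ 2`. [folklore] -/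
theorem vDerivPoly_tailPoly {j : ℕ} (hj : 2 ≤ j) (P : ℕ) :
    vDerivPoly M (tailPoly M j P) = X ^ j + C (tailResidue M j P) * X ^ (j + P + 1) := by
  have hlin : ∀ (Q R : ℝ[X]), vDerivPoly M (Q + R) = vDerivPoly M Q + vDerivPoly M R := by
    intro Q R; simp only [vDerivPoly, derivative_add]; ring
  have hsmul : ∀ (c : ℝ) (Q : ℝ[X]), vDerivPoly M (C c * Q) = C c * vDerivPoly M Q := by
    intro c Q; simp only [vDerivPoly, derivative_mul, derivative_C, zero_mul, zero_add]; ring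
  induction P with
  | zero =>
    simp only [tailPoly, zero_add, Finset.range_one, Finset.sum_singleton, add_zero, tailResidue, Nat.cast_zero]
    rw [hsmul, vDerivPoly_X_pow]
    obtain ⟨i, rfl⟩ : ∃ i, j = i + 1 := ⟨j - 1, by omega⟩
    have hi0 : (i : ℝ) ≠ 0 := Nat.cast_ne_zero.2 (by omega)
    simp only [Nat.add_sub_cancel, tailCoeff, Nat.cast_add, Nat.cast_one, add_sub_cancel_right]
    have key' : C ((i : ℝ)⁻¹) * C (i : ℝ) = 1 := by rw [← C_mul, inv_mul_cancel₀ hi0, C_1]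
    simp only [C_mul, C_neg, show i + 1 + 0 + 1 = i + 2 by ring]
    linear_combination (X : ℝ[X]) ^ (i + 1) * key'
  | succ P ih =>
    rw [tailPoly, Finset.sum_range_succ, ← tailPoly, hlin, ih, hsmul, vDerivPoly_X_pow]
    have hj1 : j - 1 + (P + 1) = j + P := by omega
    rw [hj1]
    -- the `X^{j+P+1}` terms cancel: `γ_P = α_{P+1} (j + P)`
    have hne : ((j : ℝ) + P) ≠ 0 := by
      have : (2 : ℝ) ≤ j := by exact_mod_cast hj
      positivity
    have hγ : tailResidue M j P = tailCoeff M j (P + 1) * ((j : ℝ) + P) := by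
      simp only [tailResidue, tailCoeff]
      field_simp
    have key : C (tailResidue M j P) = C (tailCoeff M j (P + 1)) * C (((j + P : ℕ) : ℝ)) := by
      rw [← C_mul, hγ]; push_cast; ring
    have key2 : C (tailResidue M j (P + 1)) = C (tailCoeff M j (P + 1)) * C (2 * M * ((j + P : ℕ) : ℝ)) := by
      rw [← C_mul]; congr 1; simp only [tailResidue]; push_cast; ring
    rw [key2, show j + (P + 1) + 1 = j + P + 2 by ring, show j + P + 1 = (j + P) + 1 by ring]
    linear_combination (X : ℝ[X]) ^ (j + P + 1) * key

omit hr hM in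
/-- `X^{j−1} ∣ A_{j,P}`. [folklore] -/
lemma X_pow_dvd_tailPoly (M : ℝ) (j P : ℕ) : X ^ (j - 1) ∣ tailPoly M j P := by
  refine Finset.dvd_sum fun p _ ↦ ?_
  exact Dvd.dvd.mul_left (pow_dvd_pow X (Nat.le_add_right _ _)) _

/-- **The explicit tail of an inverse power**: for `j ≥ 3`,
`∫_v^∞ ρ^j dv' = −A_{j,P}(ρ(v)) − γ_{j,P} ∫_v^∞ ρ^{j+P+1} dv'`. [folklore] -/
theorem integral_Ioi_inv_pow_eq (u : ℝ) {j : ℕ} (hj : 3 ≤ j) (P : ℕ) (v : ℝ) :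
    ∫ w in Ioi v, (r u w ^ j)⁻¹ =
      -(tailPoly M j P).eval (r u v)⁻¹ - tailResidue M j P * ∫ w in Ioi v, (r u w ^ (j + P + 1))⁻¹ := by
  -- `f = A(ρ)`, `f' = ρ^j + γ ρ^{j+P+1}`, `f → 0`
  have hderiv : ∀ x, HasDerivAt (fun w ↦ (tailPoly M j P).eval (r u w)⁻¹)
      ((r u x ^ j)⁻¹ + tailResidue M j P * (r u x ^ (j + P + 1))⁻¹) x := by
    intro x
    refine (hasDerivAt_eval_invRadius_vDerivPoly hr hM _ u x).congr_deriv ?_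
    rw [vDerivPoly_tailPoly (by omega)]
    simp [eval_add, eval_mul, eval_pow, eval_X, eval_C, inv_pow]
  obtain ⟨i, hi⟩ : ∃ i, j = i + 3 := ⟨j - 3, by omega⟩
  have hint1 : IntegrableOn (fun w ↦ (r u w ^ j)⁻¹) (Ioi v) := by
    rw [hi, show i + 3 = (i + 1) + 2 by ring]
    exact (isRem_inv_pow hr hM u ((i + 1) + 2)).integrableOn_Ioi hr hM v
  have hint2 : IntegrableOn (fun w ↦ (r u w ^ (j + P + 1))⁻¹) (Ioi v) := by
    rw [show j + P + 1 = (j + P - 1) + 2 by omega]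
    exact (isRem_inv_pow hr hM u ((j + P - 1) + 2)).integrableOn_Ioi hr hM v
  have hint : IntegrableOn (fun x ↦ (r u x ^ j)⁻¹ + tailResidue M j P * (r u x ^ (j + P + 1))⁻¹) (Ioi v) :=
    hint1.add (hint2.const_mul _)
  have hlim : Tendsto (fun w ↦ (tailPoly M j P).eval (r u w)⁻¹) atTop (𝓝 0) := by
    -- `|A(ρ)| ≤ K ρ^{j-1}`, `ρ → 0`
    obtain ⟨K, -, hK⟩ := exists_abs_eval_le_of_dvd hr hM (X_pow_dvd_tailPoly M j P)
    have hρ : Tendsto (fun w ↦ K * (r u w ^ (j - 1))⁻¹) atTop (𝓝 0) := by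
      have h := ((tendsto_pow_atTop (n := j - 1) (by omega)).comp (hr.tendsto_atTop hM.le u)).inv_tendsto_atTop
      simpa using h.const_mul K
    refine squeeze_zero_norm (fun w ↦ ?_) hρ
    rw [Real.norm_eq_abs]; exact hK u w
  have h := integral_Ioi_of_hasDerivAt_of_tendsto' (fun x _ ↦ hderiv x) hint hlim
  rw [integral_add hint1 (hint2.const_mul _), MeasureTheory.integral_const_mul] at h
  linear_combination h

end Tail

end VExp

end Literature.Barriers.FinalStateConjecture

end
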